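import Summits.QuantumFields.BalabanUV.T4Continuum.Support.NE7SliceGreenFlat
import Summits.QuantumFields.BalabanUV.T4Continuum.Support.NE7LandauLinearSup
import Summits.QuantumFields.BalabanUV.T4Continuum.Support.NE7BlockMeanZeroSup
import Summits.QuantumFields.BalabanUV.T4Continuum.Support.NE3SmoothRightInverseBounds
import HarnessLib

/-!
# NE7SliceSupFlat — BRICK D OF THE REP♭ ROAD: THE LINEAR SUP LETTER ON THE T4 CARRIERS, EVERY LEVEL — a T4-TANGENT direction `X`
# (`dirIter L (k+1) 1 X = 0`, `(L^{k+1}N)`-periodic) is a lattice gradient `dσ` up to `K·L^{k+1}·sup‖curl₁X‖`, with the gauge function `σ` periodic and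
# `sup‖σ‖ ≤ card n·(d+1)(L^{k+1} − 1)·(2·sup‖X‖ + K·L^{k+1}·sup‖curl₁X‖)`, `K = K(d, card n)` INDEPENDENT of `k` and `N`

Cell `pub-balaban`, sub-cell t4, lineage `b2b-balaban-t4-ne7-p1`, gen 73 (CRUX PROVER NE7 #1).  Memo `t4/b2b-balaban-t4-ne7-p1-g73/REP-FLAT-ROAD-v2.md` §2 (s3)–(s5):
the linear heart of every level of the sup induction.  THE ARGUMENT (entry by entry, `e = (i,i′)`; `n₀ := L^{k+1}`, fine torus `Tor (fine n₀ (N,…,N))`): G3b's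
`NE7SliceGreenFlat.exists_kerQ_entry` construction made explicit — `x̃_e := x_e − ∂_{n₀}(g_e)`, `g_e := n₀⁻¹·framePot L (k+1) X ∘ rep ∘ blockOf`, lies in `ker Q_k`
(F40b `qvOp_entry_coarse_exact`) with the plaquette field of the entry `x_e` (F40a `curlAt_flat_entry_torus`); B1 `NE7LandauLinearSup.exists_sup_const`:
`x̃₂ := x̃_e − ∂_{n₀}λ₀(∂*x̃_e)` has `|x̃₂| ≤ C(d)·sup|F_{n₀}(x̃_e)| = C·n₀·sup|curl₁X|_{ii′}`; so with `s_e := g_e + λ₀(∂*x̃_e)` and `σ(y)_{ii′} := n₀·s_e(toT y)`: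
`(X − dσ)(y,κ)_{ii′} = x̃₂(toT y, κ)`, `‖(X − dσ)(y,κ)‖ ≤ card n·C·n₀·B` (F37 `opNorm_le_card_mul`).  The sup of `σ`: `n₀·g_e` is a frame-potential entry, `≤ (d+1)(n₀−1)·b`
(`NE3SmoothRightInverseBounds.norm_framePot_le_of_block`); `λ₀` has zero block means (`B5Value126.QsOp_lambda0`) and its in-block steps are `n₀⁻¹(x_e − x̃₂)` (the
`blockOf`-gauge is constant inside blocks), so `NE7BlockMeanZeroSup.norm_le_of_blockMean_zero` gives `|n₀λ₀| ≤ (d+1)(n₀−1)(b + C·n₀·B)`.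
WHAT ([folklore]; 0 def, 0 sorry; dimension `d + 1`, `L ≥ 1`, every `k`, every `N ≥ 1`).  §1 `entry_letter` (one entry: the torus function `s_e` with both
letters); §2 **`sliceSup_flat`**: `∃ K > 0` depending on `d`, `card n` only such that for all `L ≥ 1`, `k`, `N`, every `(L^{k+1}N)`-periodic `X` with
`dirIter L (k+1) 1 X = 0`, every `B` bounding `‖curlAt 1 X z μ ν‖` and `b` bounding `‖X y κ‖`: there is `σ : Site → Matrix n n ℂ`, `(L^{k+1}N)`-periodic, with
`‖X(y,κ) − (σ(y + e_κ) − σ(y))‖ ≤ K·L^{k+1}·B` and `‖σ(y)‖ ≤ card n·(d+1)(L^{k+1} − 1)·(2b + K·L^{k+1}·B)` for all `y, κ`.  (Skewness: for skew `X` the consumer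
replaces `σ` by its skew part — p2's `skewPart` trick; not done here.)
HONEST FRAMING (page 1): LINEAR (flat background, abelian entry by entry); constants existential through GAN24's `C(d)`; [B5] (1.110)∕(1.115) and [B8] (1.36) are TEXT
LOCATIONS, nothing printed is asserted; the NONLINEAR step and REP♭ are NOT proved; (APE) at the trivial flat datum conditional on REP♭; NOT NE7; spine 0∕9; finite T⁴
rung (B)+1 — NOT infinite volume, NOT mass gap, NOT BetaPertH, NOT Clay.  Continuum YM on T⁴ ⇐ BetaPertH ∧ nine spine estimates (0/9 proved); BetaPertH ⇐ (D1) ∧ (D4) ∧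
CAP+tail; G-an2-4 gates asym, D1 and NE2/3/4.
-/

set_option autoImplicit false

open scoped BigOperators Matrix ComplexConjugate Matrix.Norms.L2Operator
open Finset

namespace Summit.QuantumFields.BalabanUV.T4Continuum.NE7SliceSupFlat

open Literature.MathematicalPhysics.QuantumFieldTheory.Balaban1983to89
open B7Prop1Explicit (Site e e_apply)
open T4AveragingDeficitWall (curlAt)
open AveragingDeficitPeriodicCounting (IsPeriodicDir)
open B5Prop11Plancherel (Tor fine unitVec)
open B5Action121 (Fs GradOp GradOp_mulVec sdiff_mulVec)
open B5Block118 (QvOp QsOp bpt)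
open B5Blocks16 (blockOf blockOf_bpt QsOp_blockConst)
open B5Value126 (lambda0 QsOp_lambda0)
open B5Hk160Torus (QvOp_GradOp_mulVec)
open B6LowerBound2153Torus (toT rep toT_rep)
open BlockAveragePushDirSplit (flat)
open NE3TangentFlatStructure (framePot)
open NE3TangentCovariantTower (dirIter)
open NE3CpushGaugeCovariance (dirIter_succ_eq_cpushIter)
open NE3SmoothRightInverseBounds (norm_framePot_le_of_block)
open NE7FlatHkOrthogonal (Fs_eq_mul_Fs_one qvOp_entry_coarse_exact)
open NE7FlatHkCurlLetter (opNorm_le_card_mul)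
open NE7TorusBoxDictionary (curlAt_flat_entry_torus toT_add_e' apply_rep_toT')
open NE7SliceGreenTestField (toT_add_period)
open NE7LandauLinearSup (exists_sup_const)
open NE7BlockMeanZeroSup (norm_le_of_blockMean_zero bpt_update_succ)
open Literature.Computability.QuantumComplexity.SolovayKitaev (norm_apply_le_norm)

noncomputable section

variable {d : ℕ} {n : Type*} [Fintype n] [DecidableEq n]

/-! ## §1 One entry -/

/-- **ONE ENTRY OF A T4-TANGENT DIRECTION IS A TORUS GRADIENT UP TO `C·n₀·B`, WITH A CONTROLLED POTENTIAL** (`n₀ = L^{k+1}`): given the sup letter constant `C` of B1,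
for every entry `(i,i′)` there is `s : T_η → ℂ` with `|x_{ii′}(t,κ) − n₀(s(t + e_κ) − s(t))| ≤ C·n₀·B` and `|n₀·s(t)| ≤ (d+1)(n₀−1)·(2b + C·n₀·B)`. [folklore] -/
theorem entry_letter [Nonempty n] {C : ℝ} (hC : 0 < C)
    (hsup : ∀ (m : ℕ) [NeZero m] (M : Fin (d + 1) → ℕ) [∀ μ, NeZero (M μ)] (x : Tor (fine m M) × Fin (d + 1) → ℂ), QvOp m M *ᵥ x = 0 → ∀ B : ℝ,
      (∀ (μ ν : Fin (d + 1)) (t : Tor (fine m M)), ‖Fs (fine m M) (m : ℂ) x μ ν t‖ ≤ B) →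
      ∀ i : Tor (fine m M) × Fin (d + 1), ‖(x - GradOp (fine m M) (m : ℂ) *ᵥ lambda0 m M (m : ℂ) ((GradOp (fine m M) (m : ℂ))ᴴ *ᵥ x)) i‖ ≤ C * B)
    {L : ℕ} (hL : 1 ≤ L) (k N : ℕ) [NeZero N]
    {X : Site (d + 1) → Fin (d + 1) → Matrix n n ℂ} (hXP : IsPeriodicDir X ((L ^ (k + 1) * N : ℕ) : ℤ))
    (hXT : dirIter L (k + 1) (flat (d := d + 1) (n := n)) X = 0)
    {B : ℝ} (hB : ∀ (z : Site (d + 1)) (μ ν : Fin (d + 1)), ‖curlAt (flat (d := d + 1) (n := n)) X z μ ν‖ ≤ B)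
    {b : ℝ} (hb : ∀ (y : Site (d + 1)) (κ : Fin (d + 1)), ‖X y κ‖ ≤ b) (i i' : n) :
    ∃ s : Tor (fine (L ^ (k + 1)) (fun _ : Fin (d + 1) => N)) → ℂ,
      (∀ (t : Tor (fine (L ^ (k + 1)) (fun _ : Fin (d + 1) => N))) (κ : Fin (d + 1)),
        ‖X (rep (fine (L ^ (k + 1)) (fun _ : Fin (d + 1) => N)) t) κ i i'
            - ((L ^ (k + 1) : ℕ) : ℂ) * (s (t + unitVec (fine (L ^ (k + 1)) (fun _ : Fin (d + 1) => N)) κ) - s t)‖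
          ≤ C * (((L ^ (k + 1) : ℕ) : ℝ) * B)) ∧
      (∀ t : Tor (fine (L ^ (k + 1)) (fun _ : Fin (d + 1) => N)),
        ‖((L ^ (k + 1) : ℕ) : ℂ) * s t‖ ≤ ((d + 1 : ℕ) : ℝ) * (((L ^ (k + 1) : ℕ) : ℝ) - 1) * (2 * b + C * (((L ^ (k + 1) : ℕ) : ℝ) * B))) := by
  haveI : NeZero (L ^ (k + 1)) := ⟨pow_ne_zero _ (by omega)⟩
  have hnz : ((L ^ (k + 1) : ℕ) : ℂ) ≠ 0 := by exact_mod_cast NeZero.ne (L ^ (k + 1))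
  have hn1 : (1 : ℝ) ≤ ((L ^ (k + 1) : ℕ) : ℝ) := by exact_mod_cast Nat.one_le_iff_ne_zero.mpr (NeZero.ne (L ^ (k + 1)))
  have hB0 : 0 ≤ B := (norm_nonneg _).trans (hB 0 0 0)
  have hb0 : 0 ≤ b := (norm_nonneg _).trans (hb 0 0)
  have hXT' : ReplicationRightInverse.cpushIter L k (flat (d := d + 1) (n := n)) X = 0 := by rw [← dirIter_succ_eq_cpushIter L k]; exact hXT
  -- the entry, the block potential, the `ker Q_k` representative
  set xe : Tor (fine (L ^ (k + 1)) (fun _ : Fin (d + 1) => N)) × Fin (d + 1) → ℂ :=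
    fun q => X (rep (fine (L ^ (k + 1)) (fun _ : Fin (d + 1) => N)) q.1) q.2 i i' with hxe
  set g : Tor (fine (L ^ (k + 1)) (fun _ : Fin (d + 1) => N)) → ℂ :=
    fun q => ((L ^ (k + 1) : ℕ) : ℂ)⁻¹ * framePot L (k + 1) X (rep (fun _ : Fin (d + 1) => N) (blockOf (L ^ (k + 1)) (fun _ : Fin (d + 1) => N) q)) i i' with hg
  set xt := xe - GradOp (fine (L ^ (k + 1)) (fun _ : Fin (d + 1) => N)) ((L ^ (k + 1) : ℕ) : ℂ) *ᵥ g with hxt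
  -- (a) `Q_k x̃ = 0` (G3b)
  have hQ : QvOp (L ^ (k + 1)) (fun _ : Fin (d + 1) => N) *ᵥ xt = 0 := by
    have h1 : QvOp (L ^ (k + 1)) (fun _ : Fin (d + 1) => N) *ᵥ (GradOp (fine (L ^ (k + 1)) (fun _ : Fin (d + 1) => N)) ((L ^ (k + 1) : ℕ) : ℂ) *ᵥ g)
        = GradOp (fun _ : Fin (d + 1) => N) 1
          *ᵥ (fun t => ((L ^ (k + 1) : ℕ) : ℂ)⁻¹ * framePot L (k + 1) X (rep (fun _ : Fin (d + 1) => N) t) i i') := by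
      rw [QvOp_GradOp_mulVec]
      exact congrArg _ (QsOp_blockConst (L ^ (k + 1)) (fun _ : Fin (d + 1) => N)
        (fun t => ((L ^ (k + 1) : ℕ) : ℂ)⁻¹ * framePot L (k + 1) X (rep (fun _ : Fin (d + 1) => N) t) i i'))
    funext p
    obtain ⟨t, κ⟩ := p
    rw [hxt, Matrix.mulVec_sub, Pi.sub_apply, h1, hxe, qvOp_entry_coarse_exact hL k hXP hXT' i i' t κ, GradOp_mulVec, sdiff_mulVec, one_mul,
      Pi.zero_apply, sub_self]
  -- (b) the plaquette field of `x̃` is that of the entry, of size `n₀·B`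
  have hFs : ∀ (μ ν : Fin (d + 1)) (t : Tor (fine (L ^ (k + 1)) (fun _ : Fin (d + 1) => N))),
      ‖Fs (fine (L ^ (k + 1)) (fun _ : Fin (d + 1) => N)) ((L ^ (k + 1) : ℕ) : ℂ) xt μ ν t‖ ≤ ((L ^ (k + 1) : ℕ) : ℝ) * B := by
    intro μ ν t
    have hcurl : Fs (fine (L ^ (k + 1)) (fun _ : Fin (d + 1) => N)) 1 xe μ ν t
        = curlAt (flat (d := d + 1) (n := n)) X (rep (fine (L ^ (k + 1)) (fun _ : Fin (d + 1) => N)) t) μ ν i i' := by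
      have h := curlAt_flat_entry_torus (P := L ^ (k + 1) * N) hXP (rep (fine (L ^ (k + 1)) (fun _ : Fin (d + 1) => N)) t) μ ν i i'
      rw [h]
      show Fs (fine (L ^ (k + 1)) (fun _ : Fin (d + 1) => N)) 1 xe μ ν t
        = Fs (fine (L ^ (k + 1)) (fun _ : Fin (d + 1) => N)) 1 xe μ ν (toT (fine (L ^ (k + 1)) (fun _ : Fin (d + 1) => N)) (rep (fine (L ^ (k + 1)) (fun _ : Fin (d + 1) => N)) t))
      rw [toT_rep]
    have hsame : Fs (fine (L ^ (k + 1)) (fun _ : Fin (d + 1) => N)) ((L ^ (k + 1) : ℕ) : ℂ) xt μ ν t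
        = ((L ^ (k + 1) : ℕ) : ℂ) * Fs (fine (L ^ (k + 1)) (fun _ : Fin (d + 1) => N)) 1 xe μ ν t := by
      rw [hxt, show xe - GradOp (fine (L ^ (k + 1)) (fun _ : Fin (d + 1) => N)) ((L ^ (k + 1) : ℕ) : ℂ) *ᵥ g
          = xe + GradOp (fine (L ^ (k + 1)) (fun _ : Fin (d + 1) => N)) ((L ^ (k + 1) : ℕ) : ℂ) *ᵥ (-g) by rw [Matrix.mulVec_neg]; abel,
        Beta.Ineq167Operator.Fs_add, Beta.Ineq167Operator.Fs_grad, add_zero, Fs_eq_mul_Fs_one _ (((L ^ (k + 1) : ℕ) : ℂ))]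
    rw [hsame, hcurl, norm_mul, Complex.norm_natCast]
    exact mul_le_mul_of_nonneg_left ((norm_apply_le_norm _ i i').trans (hB _ μ ν)) (Nat.cast_nonneg _)
  -- (c) B1
  set lam := lambda0 (L ^ (k + 1)) (fun _ : Fin (d + 1) => N) ((L ^ (k + 1) : ℕ) : ℂ)
    ((GradOp (fine (L ^ (k + 1)) (fun _ : Fin (d + 1) => N)) ((L ^ (k + 1) : ℕ) : ℂ))ᴴ *ᵥ xt) with hlam
  have h2 : ∀ q, ‖(xt - GradOp (fine (L ^ (k + 1)) (fun _ : Fin (d + 1) => N)) ((L ^ (k + 1) : ℕ) : ℂ) *ᵥ lam) q‖ ≤ C * (((L ^ (k + 1) : ℕ) : ℝ) * B) :=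
    fun q => hsup (L ^ (k + 1)) (fun _ : Fin (d + 1) => N) xt hQ _ hFs q
  refine ⟨fun t => g t + lam t, fun t κ => ?_, fun t => ?_⟩
  · -- the gauged entry is `x̃₂(t, κ)`
    have hid : xe (t, κ) - ((L ^ (k + 1) : ℕ) : ℂ) * ((g (t + unitVec (fine (L ^ (k + 1)) (fun _ : Fin (d + 1) => N)) κ) + lam (t + unitVec _ κ)) - (g t + lam t))
        = (xt - GradOp (fine (L ^ (k + 1)) (fun _ : Fin (d + 1) => N)) ((L ^ (k + 1) : ℕ) : ℂ) *ᵥ lam) (t, κ) := by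
      rw [hxt, Pi.sub_apply, Pi.sub_apply, GradOp_mulVec, GradOp_mulVec, sdiff_mulVec, sdiff_mulVec]
      ring
    have hxe' : X (rep (fine (L ^ (k + 1)) (fun _ : Fin (d + 1) => N)) t) κ i i' = xe (t, κ) := rfl
    rw [hxe', hid]
    exact h2 (t, κ)
  · -- the potential: frame part + Landau part
    have hgt : ((L ^ (k + 1) : ℕ) : ℂ) * g t = framePot L (k + 1) X (rep (fun _ : Fin (d + 1) => N) (blockOf (L ^ (k + 1)) (fun _ : Fin (d + 1) => N) t)) i i' := by
      rw [hg]; simp only []; rw [← mul_assoc, mul_inv_cancel₀ hnz, one_mul]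
    have hframe : ‖((L ^ (k + 1) : ℕ) : ℂ) * g t‖ ≤ ((d + 1 : ℕ) : ℝ) * (((L ^ (k + 1) : ℕ) : ℝ) - 1) * b := by
      rw [hgt]
      refine (norm_apply_le_norm _ i i').trans ?_
      have h := norm_framePot_le_of_block (d := d + 1) (n := n) hL (k + 1) X
        (rep (fun _ : Fin (d + 1) => N) (blockOf (L ^ (k + 1)) (fun _ : Fin (d + 1) => N) t)) hb0 (fun x κ _ => hb x κ)
      push_cast at h ⊢
      exact h
    -- the Landau part through the Poincaré letter
    have hstep : ∀ (y : Tor (fun _ : Fin (d + 1) => N)) (j : Fin (d + 1) → Fin (L ^ (k + 1))) (ν : Fin (d + 1)) (h : (j ν : ℕ) + 1 < L ^ (k + 1)),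
        ‖lam (bpt (L ^ (k + 1)) (fun _ : Fin (d + 1) => N) y (Function.update j ν ⟨(j ν : ℕ) + 1, h⟩)) - lam (bpt (L ^ (k + 1)) (fun _ : Fin (d + 1) => N) y j)‖
          ≤ (((L ^ (k + 1) : ℕ) : ℝ))⁻¹ * (b + C * (((L ^ (k + 1) : ℕ) : ℝ) * B)) := by
      intro y j ν h
      set t₀ := bpt (L ^ (k + 1)) (fun _ : Fin (d + 1) => N) y j with ht₀
      rw [bpt_update_succ, ← ht₀]
      -- `n₀ (λ(t₀ + e_ν) − λ(t₀)) = x̃(t₀,ν) − x̃₂(t₀,ν)` and `x̃(t₀,ν) = x_e(t₀,ν)` (the block potential is constant inside the block)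
      have hblk : blockOf (L ^ (k + 1)) (fun _ : Fin (d + 1) => N) (t₀ + unitVec (fine (L ^ (k + 1)) (fun _ : Fin (d + 1) => N)) ν)
          = blockOf (L ^ (k + 1)) (fun _ : Fin (d + 1) => N) t₀ := by
        rw [ht₀, ← bpt_update_succ (L ^ (k + 1)) (fun _ : Fin (d + 1) => N) y j ν h, blockOf_bpt, blockOf_bpt]
      have hxt₀ : xt (t₀, ν) = xe (t₀, ν) := by
        rw [hxt, Pi.sub_apply, GradOp_mulVec, sdiff_mulVec, hg]
        simp only [hblk, sub_self, mul_zero, sub_zero]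
      have hid : ((L ^ (k + 1) : ℕ) : ℂ) * (lam (t₀ + unitVec (fine (L ^ (k + 1)) (fun _ : Fin (d + 1) => N)) ν) - lam t₀)
          = xt (t₀, ν) - (xt - GradOp (fine (L ^ (k + 1)) (fun _ : Fin (d + 1) => N)) ((L ^ (k + 1) : ℕ) : ℂ) *ᵥ lam) (t₀, ν) := by
        rw [Pi.sub_apply, GradOp_mulVec, sdiff_mulVec]; ring
      have hnorm : ((L ^ (k + 1) : ℕ) : ℝ) * ‖lam (t₀ + unitVec (fine (L ^ (k + 1)) (fun _ : Fin (d + 1) => N)) ν) - lam t₀‖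
          ≤ b + C * (((L ^ (k + 1) : ℕ) : ℝ) * B) := by
        have h := congrArg (fun z : ℂ => ‖z‖) hid
        simp only [norm_mul, Complex.norm_natCast] at h
        rw [h, hxt₀]
        calc _ ≤ ‖xe (t₀, ν)‖ + ‖(xt - GradOp (fine (L ^ (k + 1)) (fun _ : Fin (d + 1) => N)) ((L ^ (k + 1) : ℕ) : ℂ) *ᵥ lam) (t₀, ν)‖ := norm_sub_le _ _
          _ ≤ b + C * (((L ^ (k + 1) : ℕ) : ℝ) * B) := add_le_add ((norm_apply_le_norm _ i i').trans (hb _ ν)) (h2 (t₀, ν))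
      exact (le_inv_mul_iff₀ (by positivity : (0 : ℝ) < ((L ^ (k + 1) : ℕ) : ℝ))).mpr hnorm
    have hQ0 : QsOp (L ^ (k + 1)) (fun _ : Fin (d + 1) => N) *ᵥ lam = 0 := QsOp_lambda0 _ _ _ hnz _
    have hg0 : 0 ≤ (((L ^ (k + 1) : ℕ) : ℝ))⁻¹ * (b + C * (((L ^ (k + 1) : ℕ) : ℝ) * B)) := by positivity
    have hlam_t := norm_le_of_blockMean_zero (L ^ (k + 1)) (fun _ : Fin (d + 1) => N) lam hQ0 hg0 hstep t
    have hlamn : ‖((L ^ (k + 1) : ℕ) : ℂ) * lam t‖ ≤ ((d + 1 : ℕ) : ℝ) * (((L ^ (k + 1) : ℕ) : ℝ) - 1) * (b + C * (((L ^ (k + 1) : ℕ) : ℝ) * B)) := by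
      rw [norm_mul, Complex.norm_natCast]
      calc _ ≤ ((L ^ (k + 1) : ℕ) : ℝ) * (((d + 1 : ℕ) : ℝ) * (((L ^ (k + 1) : ℕ) : ℝ) - 1) * ((((L ^ (k + 1) : ℕ) : ℝ))⁻¹ * (b + C * (((L ^ (k + 1) : ℕ) : ℝ) * B)))) :=
            mul_le_mul_of_nonneg_left hlam_t (Nat.cast_nonneg _)
        _ = _ := by field_simp
    calc ‖((L ^ (k + 1) : ℕ) : ℂ) * (g t + lam t)‖ = ‖((L ^ (k + 1) : ℕ) : ℂ) * g t + ((L ^ (k + 1) : ℕ) : ℂ) * lam t‖ := by rw [mul_add]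
      _ ≤ _ := norm_add_le _ _
      _ ≤ ((d + 1 : ℕ) : ℝ) * (((L ^ (k + 1) : ℕ) : ℝ) - 1) * b + ((d + 1 : ℕ) : ℝ) * (((L ^ (k + 1) : ℕ) : ℝ) - 1) * (b + C * (((L ^ (k + 1) : ℕ) : ℝ) * B)) :=
          add_le_add hframe hlamn
      _ = ((d + 1 : ℕ) : ℝ) * (((L ^ (k + 1) : ℕ) : ℝ) - 1) * (2 * b + C * (((L ^ (k + 1) : ℕ) : ℝ) * B)) := by ring

/-! ## §2 THE LETTER -/

/-- **THE LINEAR SUP LETTER ON THE T4 CARRIERS, EVERY LEVEL** (dimension `d + 1`): there is `K > 0` depending on `d` and `card n` only such that for all `L ≥ 1`,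
`k`, `N ≥ 1`, every `(L^{k+1}N)`-periodic `X` with `dirIter L (k+1) 1 X = 0`, and all `B`, `b` with `‖curlAt 1 X z μ ν‖ ≤ B`, `‖X y κ‖ ≤ b`: there is an
`(L^{k+1}N)`-periodic `σ : Site → Matrix n n ℂ` with **`‖X(y,κ) − (σ(y+e_κ) − σ(y))‖ ≤ K·L^{k+1}·B`** and **`‖σ(y)‖ ≤ card n·(d+1)(L^{k+1} − 1)·(2b + K·L^{k+1}·B)`**.
([B8] (1.36)₁ in the linear chart on T4 carriers; the sup of the gauge function is what makes the nonabelian step perturbative.) [folklore] -/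
theorem sliceSup_flat [Nonempty n] :
    ∃ K : ℝ, 0 < K ∧ ∀ (L : ℕ), 1 ≤ L → ∀ (k N : ℕ) [NeZero N]
      (X : Site (d + 1) → Fin (d + 1) → Matrix n n ℂ), IsPeriodicDir X ((L ^ (k + 1) * N : ℕ) : ℤ) →
      dirIter L (k + 1) (flat (d := d + 1) (n := n)) X = 0 →
      ∀ (B : ℝ), (∀ (z : Site (d + 1)) (μ ν : Fin (d + 1)), ‖curlAt (flat (d := d + 1) (n := n)) X z μ ν‖ ≤ B) →
      ∀ (b : ℝ), (∀ (y : Site (d + 1)) (κ : Fin (d + 1)), ‖X y κ‖ ≤ b) →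
      ∃ σ : Site (d + 1) → Matrix n n ℂ,
        (∀ (y : Site (d + 1)) (ι : Fin (d + 1)), σ (y + ((L ^ (k + 1) * N : ℕ) : ℤ) • e ι) = σ y) ∧
        (∀ (y : Site (d + 1)) (κ : Fin (d + 1)), ‖X y κ - (σ (y + e κ) - σ y)‖ ≤ K * (L : ℝ) ^ (k + 1) * B) ∧
        (∀ y : Site (d + 1), ‖σ y‖ ≤ Fintype.card n * (((d + 1 : ℕ) : ℝ) * ((L : ℝ) ^ (k + 1) - 1) * (2 * b + K * (L : ℝ) ^ (k + 1) * B))) := by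
  obtain ⟨C, hC, hsup⟩ := exists_sup_const (d := d)
  have hcard1 : (1 : ℝ) ≤ Fintype.card n := by exact_mod_cast Fintype.card_pos
  refine ⟨Fintype.card n * C, by positivity, fun L hL k N _ X hXP hXT B hB b hb => ?_⟩
  haveI : NeZero (L ^ (k + 1) * N) := ⟨Nat.mul_ne_zero (pow_ne_zero _ (by omega)) (NeZero.ne N)⟩
  have hB0 : 0 ≤ B := (norm_nonneg _).trans (hB 0 0 0)
  have hpow : ((L ^ (k + 1) : ℕ) : ℝ) = (L : ℝ) ^ (k + 1) := by push_cast; ring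
  have key := fun i i' => entry_letter hC hsup hL k N hXP hXT hB hb i i'
  choose s hs1 hs2 using key
  refine ⟨fun y => Matrix.of fun i i' => ((L ^ (k + 1) : ℕ) : ℂ) * s i i' (toT (fine (L ^ (k + 1)) (fun _ : Fin (d + 1) => N)) y), fun y ι => ?_,
    fun y κ => ?_, fun y => ?_⟩
  · -- periodicity
    ext i i'
    simp only [Matrix.of_apply]
    rw [show toT (fine (L ^ (k + 1)) (fun _ : Fin (d + 1) => N)) (y + ((L ^ (k + 1) * N : ℕ) : ℤ) • e ι)
        = toT (fine (L ^ (k + 1)) (fun _ : Fin (d + 1) => N)) y from toT_add_period (d := d + 1) (L ^ (k + 1) * N) y ι]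
  · -- the gauged field, entry by entry
    have hent : ∀ i i', ‖(X y κ - ((Matrix.of fun i i' => ((L ^ (k + 1) : ℕ) : ℂ) * s i i' (toT (fine (L ^ (k + 1)) (fun _ : Fin (d + 1) => N)) (y + e κ)))
        - Matrix.of fun i i' => ((L ^ (k + 1) : ℕ) : ℂ) * s i i' (toT (fine (L ^ (k + 1)) (fun _ : Fin (d + 1) => N)) y))) i i'‖ ≤ C * ((L : ℝ) ^ (k + 1) * B) := by
      intro i i'
      have h := hs1 i i' (toT (fine (L ^ (k + 1)) (fun _ : Fin (d + 1) => N)) y) κ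
      rw [apply_rep_toT' (P := L ^ (k + 1) * N) hXP y κ, hpow] at h
      simp only [Matrix.sub_apply, Matrix.of_apply]
      rw [toT_add_e', ← mul_sub]
      exact h
    calc _ ≤ Fintype.card n * (C * ((L : ℝ) ^ (k + 1) * B)) := opNorm_le_card_mul _ hent
      _ = Fintype.card n * C * (L : ℝ) ^ (k + 1) * B := by ring
  · -- the sup of the gauge function
    have hent : ∀ i i', ‖(Matrix.of fun i i' => ((L ^ (k + 1) : ℕ) : ℂ) * s i i' (toT (fine (L ^ (k + 1)) (fun _ : Fin (d + 1) => N)) y)) i i'‖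
        ≤ ((d + 1 : ℕ) : ℝ) * ((L : ℝ) ^ (k + 1) - 1) * (2 * b + C * ((L : ℝ) ^ (k + 1) * B)) := by
      intro i i'
      have h := hs2 i i' (toT (fine (L ^ (k + 1)) (fun _ : Fin (d + 1) => N)) y)
      rw [hpow] at h
      simpa only [Matrix.of_apply] using h
    refine (opNorm_le_card_mul _ hent).trans (mul_le_mul_of_nonneg_left ?_ (by positivity))
    have hL1 : (1 : ℝ) ≤ (L : ℝ) ^ (k + 1) := by rw [← hpow]; exact_mod_cast Nat.one_le_pow _ _ hL
    have hb0 : 0 ≤ b := (norm_nonneg _).trans (hb 0 0)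
    have h1 : C * ((L : ℝ) ^ (k + 1) * B) ≤ Fintype.card n * C * (L : ℝ) ^ (k + 1) * B := by
      have : 0 ≤ C * ((L : ℝ) ^ (k + 1) * B) := by positivity
      nlinarith
    have h2 : 0 ≤ ((d + 1 : ℕ) : ℝ) * ((L : ℝ) ^ (k + 1) - 1) := mul_nonneg (Nat.cast_nonneg _) (by linarith)
    nlinarith

end

end Summit.QuantumFields.BalabanUV.T4Continuum.NE7SliceSupFlat
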